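import Summits.Ventures.CertifiedManyBodySolver.Theorems.TcThermcert1Defs
import Summits.Ventures.CertifiedManyBodySolver.Observables.StiffnessThermalTrialGeneratorHook
import HarnessLib

/-!
# Route «hubbard-tc-thermcert-1»: row admissibility at supporting chemical potentials and the `(β, q)` rung sockets
# «certificate ⇒ leaf» with STUB 1 discharged (helpers toward crux K1, stmt-Ventures-26381)

HONEST FRAMING: one-sided CEILING chain under the thermal KT dictionary; the CERTIFICATES (`TrialGeneratorCertificateAt β q`,
`TrialGeneratorCertificateB10`) are NOT proved here — they are the cruxes' content (producers' object); KT ceilings never assert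
superconductivity; NO lower bound on `T_c` is claimed; no summit, rung or crux statement is proved in this file. Cell `pub/hubbard-tc` ×
`speedrun/mbsolver/hubbard-thermal` (D-0154 (1) block (D)); seat `hubbard-thermal-p4` (typist), on RULINGS R129/R133 of the cell lead.

* §1 (landed separately, ONE theorem for both lines): STUB 1 `TrialGeneratorHook` over the SHARED objects of
  `Theorems/TcThermcert1Defs.lean` is `TcThermcert1.Vertex.stub_trialGeneratorHook` (`Theorems/TcThermcert1VertexStubTrialGeneratorHook.lean`,
  p614740) = the tree's all-generators hook `ObsThermalStiffnessSeqCeilingAtBeta_of_torusLimit_trialGeneratorWord_le`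
  (`Observables/StiffnessThermalTrialGeneratorHook.lean`, p610464 + p611646); here the hook is invoked directly.
* §2 row admissibility (hub-tc-therm-crit-2's `Stub2Uniform.lean` 6a21b4749dbe9595 as generalised in hub-tc-therm-plan-1's registered skeleton
  752f7dabfdb82980 §1′, VERBATIM): `isThermalRowState_of_supportingMu` — every torus limit of the canonical sector Gibbs states at
  `(β; 1, t′, U; n)` (`0 ≤ U`, `0 < β`, `0 < n < 2`) is a thermal row state at EVERY supporting chemical potential `μ₀`; and
  `exists_supportingMu_mem_band` — a supporting `μ₀` exists in the lattice-gas band.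
* §3 the sockets with STUB 1 ALREADY DISCHARGED: `leafAt_of_certificateAt (hβ) : TrialGeneratorCertificateAt β q → ObsThermalStiffnessSeqCeilingAtBeta 0 8 (7/8) β q`,
  the M-K1-R1 rungs `rung_b6 : TrialGeneratorCertificateAt 6 (21/100) → … 6 (21/100)` (LEVER TEST, R129a; `(π/4)(21/100) = 0.1649 < 1/6`) and
  `rung_b5 : TrialGeneratorCertificateAt 5 (14/55) → … 5 (14/55)` (`(π/4)(14/55) = 0.19992 < 1/5`), and the crux shape
  `leaf_b10_of_certificateB10 : TrialGeneratorCertificateB10 → ObsThermalStiffnessSeqCeilingAtBeta 0 8 (7/8) 10 (1/8)` (= K1's body: the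
  crux then needs exactly ONE input, its certificate).

WHAT THIS IS NOT: no certificate, no number of record, no `T_c`; the K1 lead's milestone target remains «prove `cert6 : TrialGeneratorCertificateAt 6 (21/100)`»
(then `rung_b6 cert6` is R1(6)).

References: DLS1978 §2 eqs. (22′), (27), (28); FawziFawziScalet2024 Thm. 3.1; ArakiMoriya2003 Thm. 12.11; HazraVermaRanderia2019 eqs. (2)–(4).
-/

noncomputable section

namespace Summit.Ventures.CertifiedManyBodySolver.Theorems.TcThermcert1

open Filter Topology Matrix Finset
open Literature.MathematicalPhysics.QuantumLattice
open Literature.MathematicalPhysics.QuantumLattice.ThermodynamicLimit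
open Literature.MathematicalPhysics.QuantumFieldTheory
open Literature.MathematicalPhysics.StatisticalMechanics
open Literature.Probability.LatticeModels
open Summit.Ventures.CertifiedManyBodySolver.Observables
open scoped ComplexConjugate ComplexOrder

/-! ## §2 Row admissibility at supporting chemical potentials (crit-2 ∕ plan-1, verbatim) -/

/-- Rows at ANY supporting chemical potential, for EVERY torus limit, at every `(β; 1, t′, U; n)` with `0 ≤ U`, `0 < β`, `0 < n < 2`
(hub-tc-therm-crit-2 `Stub2Uniform.lean`, generalised by hub-tc-therm-plan-1; verbatim the registered skeleton's §1′).
[cite: FawziFawziScalet2024, Thm. 3.1] [cite: ArakiMoriya2003, Thm. 12.11] -/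
theorem isThermalRowState_of_supportingMu {tp U n β μ₀ : ℝ} (hU : 0 ≤ U) (hβ : 0 < β) (hn0 : 0 < n) (hn2 : n < 2)
    (hμ₀ : IsSupportingMu β 1 tp U n μ₀) {ω : InfVolFermionState 2} {Ls : ℕ → ℕ} (hLs : Tendsto Ls atTop atTop)
    (hω : ω.IsTorusLimitOfMixture (sectorGibbsCount n) (fun L => sectorGibbsWeightTT' β 1 tp U n L)
      (fun L => sectorGibbsVectorTT' 1 tp U n L) Ls) :
    IsThermalRowState β tp U n μ₀ ω := by
  have hμ₀' : pressureTT' β 1 tp U n = gcPressureTT' β 1 tp U μ₀ - β * μ₀ * n := by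
    unfold IsSupportingMu at hμ₀; linarith
  refine ⟨hω.isTranslationInvariant, hω.density_eq_of_sectorGibbs 1 tp U hn0.le hn2.le β hLs,
    fun Λ Λ' hΛ h8 A => ⟨?_, fun s q hq => ?_⟩, fun Λ Λ' hΛ h8 A C hAN hAS hCN hCS => ?_⟩
  · exact hω.expect_commutator_gcLocalHamiltonianTT'_eq_zero_of_sectorGibbs_of_localDKMS 1 tp hU hβ
      localDKMSOfVariationalPrincipleTTPrime_holds hn0 hn2 hLs hμ₀' hΛ h8 A
  · exact hω.re_expect_eeb_nonneg_of_sectorGibbs_of_localDKMS 1 tp hU hβ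
      localDKMSOfVariationalPrincipleTTPrime_holds hn0 hn2 hLs hμ₀' hΛ h8 A hq
  · exact hω.re_expect_bog_nonneg_of_sectorGibbs_of_thicken_subset 1 tp U hβ.le hLs hΛ h8 hAN hAS hCN hCS

/-- A supporting chemical potential exists in the lattice-gas band (`exists_chemicalPotential_mem_band`). [cite: ArakiMoriya2003, Thm. 12.11] -/
theorem exists_supportingMu_mem_band {tp U n β : ℝ} (hU : 0 ≤ U) (hβ : 0 < β) (hn0 : 0 < n) (hn2 : n < 2) :
    ∃ μ₀ : ℝ, InMuBand β 1 tp U n μ₀ ∧ IsSupportingMu β 1 tp U n μ₀ := by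
  obtain ⟨⟨μ₀, hμ₀⟩, hband⟩ := exists_chemicalPotential_mem_band hβ.le 1 tp hU hβ hn0 hn2
  exact ⟨μ₀, hband μ₀ hμ₀, hμ₀⟩

/-! ## §3 The rung sockets with STUB 1 discharged: a certificate at `(β, q)` ⇒ the leaf at `(β, q)` -/

/-- **Certificate ⇒ leaf at ANY `(β, q)`, `0 < β`, at the anchor `(8, 7/8, 0)`**: a trial-generator certificate per banded supporting `μ₀`
(`TrialGeneratorCertificateAt β q`) gives `ObsThermalStiffnessSeqCeilingAtBeta 0 8 (7/8) β q` — the all-generators hook fed through row admissibility (§2).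
[cite: DLS1978, §2 eqs. (22'), (27), (28)] [cite: HazraVermaRanderia2019, eqs. (2)–(4)] -/
theorem leafAt_of_certificateAt {β : ℝ} (hβ : 0 < β) {q : ℚ} (h : TrialGeneratorCertificateAt β q) :
    ObsThermalStiffnessSeqCeilingAtBeta 0 8 (7 / 8) β q := by
  obtain ⟨μ₀, hband, hsupp⟩ :=
    exists_supportingMu_mem_band (tp := 0) (U := 8) (n := 7 / 8) (β := β) (by norm_num) hβ (by norm_num) (by norm_num)
  obtain ⟨r, a, ha, hcert⟩ := h μ₀ hband hsupp
  refine ObsThermalStiffnessSeqCeilingAtBeta_of_torusLimit_trialGeneratorWord_le (tp := 0) (U := 8) (n := 7 / 8) (β := β) hβ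
    (by norm_num) (by norm_num) r a ha.1 ha.2.1 ha.2.2.1 ha.2.2.2 ?_
  intro ω Ls hLs hω
  exact hcert ω (isThermalRowState_of_supportingMu (by norm_num) hβ (by norm_num) (by norm_num) hsupp hLs hω)

/-- **M-K1-R1 LEVER TEST rung (R129a)**: a certificate at `β·t = 6`, level `21/100` ⇒ `ObsThermalStiffnessSeqCeilingAtBeta 0 8 (7/8) 6 (21/100)`
(`(π/4)·(21/100) = 0.1649 < 1/6`). [cite: HazraVermaRanderia2019, eqs. (2)–(4)] -/
theorem rung_b6 (h : TrialGeneratorCertificateAt 6 (21 / 100)) : ObsThermalStiffnessSeqCeilingAtBeta 0 8 (7 / 8) 6 (21 / 100) :=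
  leafAt_of_certificateAt (by norm_num) h

/-- **M-K1-R1 by-product rung (R129)**: a certificate at `β·t = 5`, level `14/55` ⇒ `ObsThermalStiffnessSeqCeilingAtBeta 0 8 (7/8) 5 (14/55)`
(`(π/4)·(14/55) = 0.19992 < 1/5`). [cite: HazraVermaRanderia2019, eqs. (2)–(4)] -/
theorem rung_b5 (h : TrialGeneratorCertificateAt 5 (14 / 55)) : ObsThermalStiffnessSeqCeilingAtBeta 0 8 (7 / 8) 5 (14 / 55) :=
  leafAt_of_certificateAt (by norm_num) h

/-- **The crux shape with STUB 1 discharged**: the K1 certificate `TrialGeneratorCertificateB10` alone gives the K1 body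
`ObsThermalStiffnessSeqCeilingAtBeta 0 8 (7/8) 10 (1/8)`. [cite: HazraVermaRanderia2019, eqs. (2)–(4)] -/
theorem leaf_b10_of_certificateB10 (h : TrialGeneratorCertificateB10) : ObsThermalStiffnessSeqCeilingAtBeta 0 8 (7 / 8) 10 (1 / 8) :=
  leafAt_of_certificateAt (by norm_num) (trialGeneratorCertificateB10_iff.mp h)

end Summit.Ventures.CertifiedManyBodySolver.Theorems.TcThermcert1
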